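import Summits.QuantumFields.YangMills.Theorems.BalabanUVNodesK0AxMomentBoxSocket
import Summits.QuantumFields.BalabanUV.Gaps.EndRunwiseCone
import Summits.QuantumFields.BalabanUV.Gaps.EndSurvivorCensus

/-!
# BalabanUVNodes ∕ K0ᴬ–K1ᴬ — LENS P3 §6: THE JUNCTION SOCKET's TWO NON-|β| ROWS IN KERNEL CURRENCY (the floor (iv) and the history-continuity (C) of the
# re-centred β of record, fed from letters on Bałaban's limit activities `recordPlimAx`; rate-free)

LANDING (porter PTC-1 g3, 2026-08-31): landed VERBATIM from the ideation cell's HOME sketch `nodeO-cover/P3-K1AxSocketKernel-v1.lean` (sha16 99d91c8e95a15bc9, 252 l.,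
author seat ★ P3 gen 89, OFFER №4 08:00:58Z) as a K0ᴬ helper `--supports stmt-QuantumFields-27238 --as helper` under the basename the author named
(`…K0AxMomentSocketRows`); only this paragraph was added.  CONDITIONAL helpers only: the four `def … : Prop` below are HYPOTHESIS SHAPES (open, Bałaban-strength), every
theorem takes them as hypotheses; nothing of [B12]∕[B13] is asserted, ported, discharged or refuted; K0ᴬ (stmt-27238) stays OPEN.

IDEATION CELL `ym-nodeO-ideate`, author seat ★ P3 («weaken the target»), gen 89 — a typed SKETCH offered to the porters (count-neutral seat; nothing here is
filed by the author).  Sixth module of the moment road after `…K0AxMomentRoad` (p814271), `…K0AxMomentDoor` (p814339), `…K0AxMomentBox` ∕ `…K0AxMomentBoxSocket`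
(PTC-1 INTENT-27∕28).  Namespace `Summit.QuantumFields.YangMills.Theorems.K0AxMomentRoad` (shared with those files).

WHAT §5c LEFT DISPLAYED.  `…K0AxMomentBoxSocket.cofinalBetaSocketAxBody_of_absMomentBox_of_floor_of_cont` feeds the |β| half of the K0ᴬ–K1ᴬ junction's binder `hβc`
(`BalabanUVNodes.N24K0K1JunctionOfCofinalBetaSocketAx`) from the box absolute-moment letter (L-absmom-box) and keeps TWO rows as hypotheses in β-currency:
the run-wise partial-sum FLOOR (iv) `−M′ ≤ Σ_{i∈[k,n)} β∘ i (gs₀,…,gs_i)` along in-window solutions of (0.20), and the CONTINUITY (C) of `x ↦ β∘ k (clampPrefix β∘ γ₁ k x)` on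
the survivor sets — `β∘ := betaOfRecord₁₃Ax F 2 (thetaFill F a₀ ε₂₉)`, which ON THE BOX `]0, ½]^{k+1}` IS the signed (1.22)-moment `Σ_z Π(z) z₀ z₁` of the LIMIT kernel
`recordPlimAx F a₀ ε₂₉ k v` (`K0RecordFormatNamesLemmas4.betaOfRecord₁₃Ax_thetaFill_of_mem_box`).

THIS FILE TYPES BOTH ROWS OVER `recordPlimAx` (LENS P3: the WEAKEST kernel-level letters the rows consume as typed) and composes the whole socket body:
* §6a LETTERS on the box `]0, γ]^{k+1}` at the record: (L-cont-box) `RecordPlimContOnBoxAx F a₀ ε₂₉ γ` — termwise continuity of `v ↦ Π_{k+1}(v; z)₀₁` in the history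
  ([I] §1 p.264 after (1.22): «smooth functions of g_j», asserted without proof); (L-dom-box) `RecordPlimMomentDominatedOnBoxAx F a₀ ε₂₉ γ` — at EACH scale `k` SOME summable
  majorant `m_k(z)` of the moment terms `|Π_{k+1}(v; z)₀₁|·|z₀|·|z₁|` uniform in the box history `v` (NO rate, NO uniformity in `k`: the Weierstrass M-test input and nothing
  more); (L-negpart-box) `RecordPlimMomentNegPartOnBoxAx F a₀ ε₂₉ γ e` — the signed (1.22)-moment is `≥ −e_k` on the box with `e ≥ 0` SUMMABLE (the weakest typed form of the
  asymptotic-freedom SIGN content behind the first sentence of [I] Thm 2: only the summable NEGATIVE PART of β is read by the floor); (L-AF-box)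
  `RecordPlimMomentEventuallyNonnegOnBoxAx F a₀ ε₂₉ γ k₀` — the sign from some scale `k₀` on ([I] Thm 2 (0.31) p.259 with `β > 0`; (5.44) p.297).
* §6b ORDER: per-scale box (5.10)-decay ⟹ (L-dom-box) (`m_k := C_k·|z|₁² e^{−δ_{1,k}|z|₁}`, `B12Sec2to5.majorant_summable`); (L-AF-box) with `k₀ := 0` is the sign everywhere.
  (L-dom-box) and §5's (L-absmom-box) are INCOMPARABLE as typed: the first is per-scale but dominated uniformly in `v`, the second uniform in `k, v` but only a bound on
  the sum — uniform box decay pays both.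
* §6c β-LEVEL CONSEQUENCES at `thetaFill` (level `γ ≤ ½`): ★ `betaContH_thetaFill_of_cont_dominated` — (L-cont-box) + (L-dom-box) ⟹ `BetaContH γ β∘` (Mathlib's
  `continuousOn_tsum`; the tree's RATED road `Beta.BetaContinuity.betaContH_of_kernel` ∕ `N26BetaContRecord.betaContH_betaOfMerged_of_kernel` asks per-scale UNIFORM (5.10)
  instead — recovered as the corollary `betaContH_thetaFill_of_cont_decayBox`); ★ `betaPartialSumsLowerH_thetaFill_of_negPart` — (L-negpart-box) ⟹
  `BetaPartialSumsLowerH (Σ' e) γ β∘`; `betaPartialSumsLowerH_thetaFill_of_lowerBox_eventuallyNonneg` — |β|-box floor `−M` + (L-AF-box) ⟹ `BetaPartialSumsLowerH (M·k₀) γ β∘`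
  (`FlowStepRuns.betaPartialSumsLowerH_of_eventualLower` BY NAME).
* §6d THE SOCKET's ROW SHAPES: `socketFloor_thetaFill_of_betaPartialSumsLowerH` ((iv) at any level `γ₁ ≤ γ`, `Gaps.EndRunwiseCone.runwisePS_of_betaPartialSumsLowerH` BY NAME) and
  `socketCont_thetaFill_of_betaContH` ((C) on the survivor sets of level `γ₁ ≤ γ`, `Gaps.EndSurvivorCensus.survCont_of_betaContH` BY NAME).
* §6e ★★ `cofinalBetaSocketAxBody_of_plimBoxLetters` — FOUR kernel-currency letters at ONE radius `a₀ ≤ a` and level `γ₀ ≤ ½` ((L-absmom-box) `M`, (L-cont-box), (L-dom-box),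
  (L-negpart-box) `e`) inhabit the junction's socket body `CofinalBetaSocketAxBody F a` (box `β′ := M`, row (i) `b := 0, r := M`, floor `M′ := Σ' e`, (C), all at `γ₁ := γ₀`);
  ★★ `…_of_plimBoxLetters_eventuallyNonneg` — the same with (L-AF-box) in place of (L-negpart-box) (floor `M·k₀`); ★★★ `record13SepCoPHInhabitedAx_of_plimBoxLetters_cofinalRadii` ∕
  `…_eventuallyNonneg_cofinalRadii` ∕ `…_of_contDecayBox_eventuallyNonneg_cofinalRadii` — K0ᴬ `Theses.BalabanUVNodes.Record13SepCoPHInhabitedAx` BY NAME from those letters at cofinally small radii (through the socket's projection;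
  K0ᴬ itself reads only the |β| half — the point of the composite is that the SAME producer is the junction's `hβc`, from which
  `N24K0K1JunctionOfCofinalBetaSocketAx.uv_of_cofinalBetaSocketAx_of_k1Ax_of_k3Ax` reads the rung R4 given K1ᴬ and K3ᴬ; that junction module is not imported here, to stay
  clear of `…K2AxHolds`).

THE LENS-P3 EDGE TABLE COMPLETED AT K1ᴬ (numbers, not adjectives): of the junction binder's seven displayed rows — box lower∕upper, row (i), floor (iv), continuity (C), and the
two positivity guards — §5 fed three from (L-absmom-box); §6 feeds (iv) from (L-negpart-box) (or (L-AF-box) + the |β|-box) and (C) from (L-cont-box) + (L-dom-box); the guards are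
`0 < γ₀`, `0 < ε₂₉`.  So EVERY row of `hβc` is now typed over `recordPlimAx` letters, none of which carries a (5.10) RATE: the uniform statement short of [B12] Thm 2 that the
28-node DAG consumes AS TYPED at the K0ᴬ–K1ᴬ junction is «box-uniform absolute (1.22)-moments + termwise history-continuity with per-scale domination + summable negative parts
of the signed (1.22)-moment, of the limit activities at cofinally small radii».  What it is NOT: none of these letters is proved, asserted, ported or discharged here; they
are OPEN Bałaban-strength content ([I] (1.21)–(1.22) p.264, (5.10) p.293, (5.38)–(5.44) pp.296–297, Thm 2 p.259); K0ᴬ ∕ K1ᴬ ∕ K3ᴬ stay OPEN; NODE O 0∕1; finite 𝕋⁴ at fixed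
ε — not continuum ∕ OS ∕ Clay; the Yang–Mills mass gap is NOT proved by any of this.

PROVENANCE.  The rated (C) road ((C-pt) + uniform (5.10), M-test) is `Beta.BetaContinuity` ∕ `BalabanUVNodesN26BetaContRecord` (dag-n26 lanes); the run-wise floor and the
survivor continuity conversions are the Gaps END lanes' (`EndRunwiseCone`, `EndSurvivorCensus`); (A-ps) from an eventual lower bound is `FlowStepRuns.betaPartialSumsLowerH_of_eventualLower`.
New here: the rate-free domination and negative-part letters AT THE Ax RECORD (`recordPlimAx`, `thetaFill`), their order, and the composition into the junction's socket body.
-/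

open scoped BigOperators Matrix.Norms.L2Operator Topology
open Set Filter
open Summit.QuantumFields.YangMills.Theorems.K0RecordFormatNames
open Summit.QuantumFields.YangMills.Theorems
open Literature.MathematicalPhysics.QuantumFieldTheory.Balaban1983to89
open Literature.MathematicalPhysics.QuantumFieldTheory.Balaban1983to89.Node00
open Literature.MathematicalPhysics.QuantumFieldTheory.Balaban1983to89.T4Continuum (T4Family)
open Literature.MathematicalPhysics.QuantumFieldTheory.Balaban1983to89.FlowStep
open Literature.MathematicalPhysics.QuantumFieldTheory.Balaban1983to89.FlowStepRuns
open Literature.MathematicalPhysics.QuantumFieldTheory.Balaban1983to89.B12Sec2to5 (l1 Decay510 majorant_summable abs_term_le_of_decay510)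
open Summit.QuantumFields.BalabanUV.Gaps.EndRunwiseCone (runwisePS_of_betaPartialSumsLowerH)
open Summit.QuantumFields.BalabanUV.Gaps.EndSurvivorCensus (survCont_of_betaContH)

namespace Summit.QuantumFields.YangMills.Theorems.K0AxMomentRoad

variable (F : T4Family) (a₀ ε₂₉ : ℝ)

/-! ## §6a The letters: continuity, per-scale domination, summable negative parts, eventual sign — on the box, at the record -/

/-- **(L-cont-box) — RECEIPT «TERMWISE HISTORY-CONTINUITY OF THE LIMIT ACTIVITIES AT THE RECORD»**: at every step `k` and every site `z ∈ ℤ⁴` the `(0, 1)`-entry of the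
LIMIT kernel `v ↦ recordPlimAx F a₀ ε₂₉ k v 0 1 z` is continuous in the box history `v ∈ ]0, γ]^{k+1}`.  ([I] asserts after (1.22) that the β-functions are smooth in the `g_j`;
no proof is printed.)  (HYPOTHESIS SHAPE — bookkeeping over accepted tree names, NOT a published result as typed; open.) [cite: Balaban1987RG1, §1 p.264 (after (1.22)), (1.21) p.264] -/
def RecordPlimContOnBoxAx (γ : ℝ) : Prop :=
  ∀ (k : ℕ) (z : Fin 4 → ℤ), ContinuousOn (fun v : Fin (k + 1) → ℝ => recordPlimAx F a₀ ε₂₉ k v 0 1 z) (Box γ k)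

/-- **(L-dom-box) — RECEIPT «PER-SCALE DOMINATION OF THE (1.22)-MOMENT TERMS, UNIFORM IN THE HISTORY»**: at EACH step `k` SOME summable `m_k : ℤ⁴ → ℝ` with
`|recordPlimAx F a₀ ε₂₉ k v 0 1 z|·|z₀|·|z₁| ≤ m_k z` for all box histories `v`.  The Weierstrass M-test input and nothing more: NO (5.10) rate, NO uniformity in `k`
(incomparable with (L-absmom-box), which is uniform in `k` but only bounds the sum).  (HYPOTHESIS SHAPE; open.) [cite: Balaban1987RG1, (1.21)–(1.22) p.264, (5.10) p.293, (5.42) p.297] -/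
def RecordPlimMomentDominatedOnBoxAx (γ : ℝ) : Prop :=
  ∀ k : ℕ, ∃ m : (Fin 4 → ℤ) → ℝ, Summable m ∧
    ∀ (v : Fin (k + 1) → ℝ), v ∈ Box γ k → ∀ z : Fin 4 → ℤ, |recordPlimAx F a₀ ε₂₉ k v 0 1 z| * |(z 0 : ℝ)| * |(z 1 : ℝ)| ≤ m z

/-- **(L-negpart-box) — RECEIPT «SUMMABLE NEGATIVE PARTS OF THE SIGNED (1.22)-MOMENT AT THE RECORD»**: nonnegative summable `e : ℕ → ℝ` with
`−e_k ≤ Σ_z recordPlimAx F a₀ ε₂₉ k v 0 1 z · z₀ z₁` for every box history — the weakest typed form of the SIGN content of asymptotic freedom that the junction's partial-sum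
floor reads (only the negative part of β, and only its sum).  (HYPOTHESIS SHAPE; open.) [cite: Balaban1987RG1, Thm 2 (0.31) p.259, (1.22) p.264, (5.38)–(5.44) pp.296–297] -/
def RecordPlimMomentNegPartOnBoxAx (γ : ℝ) (e : ℕ → ℝ) : Prop :=
  (∀ k, 0 ≤ e k) ∧ Summable e ∧
    ∀ (k : ℕ) (v : Fin (k + 1) → ℝ), v ∈ Box γ k → -e k ≤ B12Beta.secondMoment (recordPlimAx F a₀ ε₂₉ k v) 0 1

/-- **(L-AF-box) — RECEIPT «EVENTUAL SIGN OF THE (1.22)-MOMENT AT THE RECORD»**: from some step `k₀` on, the signed `(0, 1)`-second moment of the limit kernel is `≥ 0` on the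
box (asymptotic freedom in its qualitative form: [I] Thm 2's lower running (0.31) has `β > 0`).  (HYPOTHESIS SHAPE; open.) [cite: Balaban1987RG1, Thm 2 (0.31) p.259, (5.44) p.297] -/
def RecordPlimMomentEventuallyNonnegOnBoxAx (γ : ℝ) (k₀ : ℕ) : Prop :=
  ∀ k : ℕ, k₀ ≤ k → ∀ (v : Fin (k + 1) → ℝ), v ∈ Box γ k → 0 ≤ B12Beta.secondMoment (recordPlimAx F a₀ ε₂₉ k v) 0 1

/-! ## §6b Order among the letters -/

/-- **Per-scale box (5.10) ⟹ (L-dom-box)** with `m_k := C_k·(|z|₁² e^{−δ_{1,k}|z|₁})` (`B12Sec2to5.abs_term_le_of_decay510`, `majorant_summable`): the domination letter sits BELOW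
every decay letter, rated or per-scale. [cite: Balaban1987RG1, (5.10) p.293, (5.42) p.297] -/
theorem recordPlimMomentDominatedOnBoxAx_of_decayBox {γ : ℝ}
    (h : ∀ k : ℕ, ∃ C δ₁ : ℝ, 0 < δ₁ ∧ ∀ (v : Fin (k + 1) → ℝ), v ∈ Box γ k → Decay510 (recordPlimAx F a₀ ε₂₉ k v 0 1) C δ₁) :
    RecordPlimMomentDominatedOnBoxAx F a₀ ε₂₉ γ := fun k => by
  obtain ⟨C, δ₁, hδ, hd⟩ := h k
  refine ⟨fun z => C * (l1 z ^ 2 * Real.exp (-δ₁ * l1 z)), (majorant_summable hδ 4).mul_left C, fun v hv z => ?_⟩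
  have := abs_term_le_of_decay510 (hd v hv) 0 1 z
  rwa [abs_mul, abs_mul] at this

/-- (L-absmom-box) forces `0 ≤ M` (the box `]0, γ]^{1}` is inhabited for `γ > 0`). [folklore] -/
theorem nonneg_of_recordPlimAbsMomentOnBoxAx {γ M : ℝ} (hγ : 0 < γ) (h : RecordPlimAbsMomentOnBoxAx F a₀ ε₂₉ γ M) : 0 ≤ M := by
  have hv : (fun _ : Fin (0 + 1) => γ) ∈ Box γ 0 := mem_box.mpr fun _ => ⟨hγ, le_rfl⟩
  exact (tsum_nonneg fun z => absMomentTerm_nonneg (recordPlimAx F a₀ ε₂₉ 0 (fun _ => γ) 0 1) 0 1 z).trans (h 0 _ hv).2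

/-! ## §6c β-level consequences at `thetaFill` (level `γ ≤ ½`, where the re-centred β IS the (1.22)-moment of `recordPlimAx`) -/

/-- ★ **(L-cont-box) + (L-dom-box) ⟹ (C) ON THE BOXES, RATE-FREE**: `BetaContH γ (betaOfRecord₁₃Ax F 2 (thetaFill F a₀ ε₂₉))` for `γ ≤ ½` — Mathlib's `continuousOn_tsum`
(Weierstrass M-test with the per-scale majorant `m_k`) and the box identity `betaOfRecord₁₃Ax_thetaFill_of_mem_box`.  The tree's road `Beta.BetaContinuity.betaContH_of_kernel`
asks per-scale UNIFORM (5.10) decay instead; the domination letter is the weaker input the M-test actually reads.  CONDITIONAL; nothing asserted.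
[cite: Balaban1987RG1, §1 p.264 (after (1.22)), (1.22) p.264, (5.42) p.297] -/
theorem betaContH_thetaFill_of_cont_dominated {γ : ℝ} (hγh : γ ≤ 1 / 2) (hc : RecordPlimContOnBoxAx F a₀ ε₂₉ γ)
    (hd : RecordPlimMomentDominatedOnBoxAx F a₀ ε₂₉ γ) : BetaContH γ (betaOfRecord₁₃Ax F 2 (thetaFill F a₀ ε₂₉)) := fun k => by
  obtain ⟨m, hm, hdom⟩ := hd k
  have h := continuousOn_tsum (f := fun (z : Fin 4 → ℤ) (v : Fin (k + 1) → ℝ) => recordPlimAx F a₀ ε₂₉ k v 0 1 z * (z 0 : ℝ) * (z 1 : ℝ))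
    (fun z => ((hc k z).mul continuousOn_const).mul continuousOn_const) hm
    (fun z v hv => by rw [Real.norm_eq_abs, abs_mul, abs_mul]; exact hdom v hv z)
  exact h.congr fun v hv => by rw [betaOfRecord₁₃Ax_thetaFill_of_mem_box F a₀ ε₂₉ (box_mono hγh hv)]; rfl

/-- … COROLLARY, the rated road recovered: (L-cont-box) + per-scale box (5.10) ⟹ (C) on the boxes (= `Beta.BetaContinuity.betaContH_of_kernel` read at the Ax record).
[cite: Balaban1987RG1, (1.22) p.264, (5.10) p.293] -/
theorem betaContH_thetaFill_of_cont_decayBox {γ : ℝ} (hγh : γ ≤ 1 / 2) (hc : RecordPlimContOnBoxAx F a₀ ε₂₉ γ)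
    (h : ∀ k : ℕ, ∃ C δ₁ : ℝ, 0 < δ₁ ∧ ∀ (v : Fin (k + 1) → ℝ), v ∈ Box γ k → Decay510 (recordPlimAx F a₀ ε₂₉ k v 0 1) C δ₁) :
    BetaContH γ (betaOfRecord₁₃Ax F 2 (thetaFill F a₀ ε₂₉)) :=
  betaContH_thetaFill_of_cont_dominated F a₀ ε₂₉ hγh hc (recordPlimMomentDominatedOnBoxAx_of_decayBox F a₀ ε₂₉ h)

/-- ★ **(L-negpart-box) ⟹ THE ALL-HISTORY PARTIAL-SUM FLOOR** `BetaPartialSumsLowerH (Σ' e) γ β∘` (`γ ≤ ½`): along every history in `]0, γ]` the partial sums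
`Σ_{j∈[k,n)} β∘ j` are `≥ −Σ_{j∈[k,n)} e_j ≥ −Σ' e`.  CONDITIONAL; nothing asserted. [cite: Balaban1987RG1, Thm 2 p.259 (first sentence), (1.22) p.264, (5.38)–(5.44) pp.296–297] -/
theorem betaPartialSumsLowerH_thetaFill_of_negPart {γ : ℝ} {e : ℕ → ℝ} (hγh : γ ≤ 1 / 2) (h : RecordPlimMomentNegPartOnBoxAx F a₀ ε₂₉ γ e) :
    BetaPartialSumsLowerH (∑' j, e j) γ (betaOfRecord₁₃Ax F 2 (thetaFill F a₀ ε₂₉)) := by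
  intro g hg k n _
  have hbox : ∀ j, prefixOf g j ∈ Box γ j := fun j => mem_box.mpr fun i => hg i
  have hpt : ∀ j ∈ Finset.Ico k n, -e j ≤ betaOfRecord₁₃Ax F 2 (thetaFill F a₀ ε₂₉) j (prefixOf g j) := fun j _ => by
    rw [betaOfRecord₁₃Ax_thetaFill_of_mem_box F a₀ ε₂₉ (box_mono hγh (hbox j))]
    exact h.2.2 j _ (hbox j)
  have hle : ∑ j ∈ Finset.Ico k n, e j ≤ ∑' j, e j := h.2.1.sum_le_tsum (Finset.Ico k n) fun j _ => h.1 j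
  calc -(∑' j, e j) ≤ -(∑ j ∈ Finset.Ico k n, e j) := neg_le_neg hle
    _ = ∑ j ∈ Finset.Ico k n, -e j := (Finset.sum_neg_distrib (f := e) (s := Finset.Ico k n)).symm
    _ ≤ ∑ j ∈ Finset.Ico k n, betaOfRecord₁₃Ax F 2 (thetaFill F a₀ ε₂₉) j (prefixOf g j) := Finset.sum_le_sum hpt

/-- **|β|-BOX FLOOR + (L-AF-box) ⟹ THE PARTIAL-SUM FLOOR `M·k₀`** (`FlowStepRuns.betaPartialSumsLowerH_of_eventualLower` BY NAME, `b := 0`): the finitely many early scales are paid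
by the box floor `−M`, the tail by the sign.  CONDITIONAL. [cite: Balaban1987RG1, Thm 2 (0.31) p.259, §1 p.264, (5.44) p.297] -/
theorem betaPartialSumsLowerH_thetaFill_of_lowerBox_eventuallyNonneg {γ M : ℝ} {k₀ : ℕ} (hγh : γ ≤ 1 / 2) (hM : 0 ≤ M)
    (hlo : BetaLowerH (-M) γ (betaOfRecord₁₃Ax F 2 (thetaFill F a₀ ε₂₉))) (hev : RecordPlimMomentEventuallyNonnegOnBoxAx F a₀ ε₂₉ γ k₀) :
    BetaPartialSumsLowerH (M * k₀) γ (betaOfRecord₁₃Ax F 2 (thetaFill F a₀ ε₂₉)) :=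
  betaPartialSumsLowerH_of_eventualLower le_rfl hM
    (fun k hk v hv => by
      rw [betaOfRecord₁₃Ax_thetaFill_of_mem_box F a₀ ε₂₉ (box_mono hγh hv)]
      exact hev k hk v hv)
    (fun k v hv => hlo k v hv)

/-! ## §6d The junction socket's row shapes: (iv) along in-window runs, (C) on the survivor sets -/

/-- **(iv) THE RUN-WISE FLOOR at any level `γ₁ ≤ γ`** from the all-history floor (`Gaps.EndRunwiseCone.runwisePS_of_betaPartialSumsLowerH` BY NAME: an in-window run up to `n` extends to
a `]0, γ₁]`-history). [cite: Balaban1987RG1, Thm 2 p.259 (first sentence), (0.20) p.256 (bookkeeping)] -/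
theorem socketFloor_thetaFill_of_betaPartialSumsLowerH {γ γ₁ M : ℝ} (hγ₁ : 0 < γ₁) (hγ₁le : γ₁ ≤ γ)
    (h : BetaPartialSumsLowerH M γ (betaOfRecord₁₃Ax F 2 (thetaFill F a₀ ε₂₉))) :
    ∀ (n : ℕ) (gs : ℕ → ℝ), RGEqH n (betaOfRecord₁₃Ax F 2 (thetaFill F a₀ ε₂₉)) gs → Step.InInterval γ₁ n gs →
      ∀ k, k ≤ n → -M ≤ ∑ i ∈ Finset.Ico k n, betaOfRecord₁₃Ax F 2 (thetaFill F a₀ ε₂₉) i (prefixOf gs i) :=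
  runwisePS_of_betaPartialSumsLowerH hγ₁ (betaPartialSumsLowerH_mono hγ₁le h)

/-- **(C) ON THE SURVIVOR SETS at any level `γ₁ ≤ γ`** from (C) on the boxes (`Gaps.EndSurvivorCensus.survCont_of_betaContH` BY NAME: the clamped forward run is continuous in the
trial coupling and stays in the box). [cite: Balaban1987RG1, §1 pp.263–264, (0.20) p.256 (bookkeeping)] -/
theorem socketCont_thetaFill_of_betaContH {γ γ₁ : ℝ} (hγ₁ : 0 < γ₁) (hγ₁le : γ₁ ≤ γ) (h : BetaContH γ (betaOfRecord₁₃Ax F 2 (thetaFill F a₀ ε₂₉))) :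
    ∀ k : ℕ, ContinuousOn (fun x : ℝ => betaOfRecord₁₃Ax F 2 (thetaFill F a₀ ε₂₉) k
        (clampPrefix (betaOfRecord₁₃Ax F 2 (thetaFill F a₀ ε₂₉)) γ₁ k x))
      {x : ℝ | 0 < x ∧ x ≤ γ₁ ∧ ∀ i, i ≤ k → 1 / γ₁ ^ 2 ≤ Y (betaOfRecord₁₃Ax F 2 (thetaFill F a₀ ε₂₉)) γ₁ i x} :=
  survCont_of_betaContH hγ₁ fun k => (h k).mono (FlowStep.box_mono hγ₁le k)

--§6e-BEGIN
/-! ## §6e ★★ The whole junction socket body from four kernel-currency letters; ★★★ K0ᴬ by name -/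

/-- ★★ **THE K0ᴬ–K1ᴬ JUNCTION SOCKET FROM LIMIT-KERNEL BOX LETTERS ALONE**: at ONE radius `0 < a₀ ≤ a` and level `0 < γ₀ ≤ ½` (`ε₂₉ > 0`), (L-absmom-box) `M` + (L-cont-box) + (L-dom-box) +
(L-negpart-box) `e` inhabit `CofinalBetaSocketAxBody F a` — box `β′ := M`, row (i) `b := 0, r := M` (§5c), floor (iv) `M′ := Σ' e` (§6c∕§6d), continuity (C) (§6c∕§6d), all at
`γ₁ := γ₀`.  Every displayed row of the junction's `hβc` is thereby fed from `recordPlimAx` letters, none carrying a (5.10) rate.  CONDITIONAL; the letters are OPEN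
Bałaban-strength content; nothing asserted. [cite: Balaban1987RG1, Thm 2 p.259, Thm 3 p.264, (0.20) p.256, §1 pp.263–264, (1.21)–(1.22) p.264, (5.38)–(5.44) pp.296–297] -/
theorem cofinalBetaSocketAxBody_of_plimBoxLetters {a γ₀ M : ℝ} {e : ℕ → ℝ} (ha₀ : 0 < a₀) (hle : a₀ ≤ a) (hγ₀ : 0 < γ₀) (hγh : γ₀ ≤ 1 / 2)
    (hε : 0 < ε₂₉) (habs : RecordPlimAbsMomentOnBoxAx F a₀ ε₂₉ γ₀ M) (hc : RecordPlimContOnBoxAx F a₀ ε₂₉ γ₀)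
    (hd : RecordPlimMomentDominatedOnBoxAx F a₀ ε₂₉ γ₀) (hneg : RecordPlimMomentNegPartOnBoxAx F a₀ ε₂₉ γ₀ e) :
    CofinalBetaSocketAxBody F a :=
  cofinalBetaSocketAxBody_of_absMomentBox_of_floor_of_cont F a₀ ε₂₉ ha₀ hle hγ₀ hγh hε habs hγ₀ le_rfl
    (socketFloor_thetaFill_of_betaPartialSumsLowerH F a₀ ε₂₉ hγ₀ le_rfl (betaPartialSumsLowerH_thetaFill_of_negPart F a₀ ε₂₉ hγh hneg))
    (socketCont_thetaFill_of_betaContH F a₀ ε₂₉ hγ₀ le_rfl (betaContH_thetaFill_of_cont_dominated F a₀ ε₂₉ hγh hc hd))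

/-- ★★ **… THE SAME WITH THE EVENTUAL SIGN (L-AF-box) IN PLACE OF (L-negpart-box)** (floor `M′ := M·k₀`; the |β|-box floor `−M` comes from (L-absmom-box) itself, §5a).
CONDITIONAL; nothing asserted. [cite: Balaban1987RG1, Thm 2 (0.31) p.259, Thm 3 p.264, (1.22) p.264, (5.44) p.297] -/
theorem cofinalBetaSocketAxBody_of_plimBoxLetters_eventuallyNonneg {a γ₀ M : ℝ} {k₀ : ℕ} (ha₀ : 0 < a₀) (hle : a₀ ≤ a) (hγ₀ : 0 < γ₀) (hγh : γ₀ ≤ 1 / 2)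
    (hε : 0 < ε₂₉) (habs : RecordPlimAbsMomentOnBoxAx F a₀ ε₂₉ γ₀ M) (hc : RecordPlimContOnBoxAx F a₀ ε₂₉ γ₀)
    (hd : RecordPlimMomentDominatedOnBoxAx F a₀ ε₂₉ γ₀) (hev : RecordPlimMomentEventuallyNonnegOnBoxAx F a₀ ε₂₉ γ₀ k₀) :
    CofinalBetaSocketAxBody F a :=
  cofinalBetaSocketAxBody_of_absMomentBox_of_floor_of_cont F a₀ ε₂₉ ha₀ hle hγ₀ hγh hε habs hγ₀ le_rfl
    (socketFloor_thetaFill_of_betaPartialSumsLowerH F a₀ ε₂₉ hγ₀ le_rfl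
      (betaPartialSumsLowerH_thetaFill_of_lowerBox_eventuallyNonneg F a₀ ε₂₉ hγh (nonneg_of_recordPlimAbsMomentOnBoxAx F a₀ ε₂₉ hγ₀ habs)
        (betaBox_thetaFill_of_recordPlimAbsMomentOnBoxAx F a₀ ε₂₉ hγh habs).2 hev))
    (socketCont_thetaFill_of_betaContH F a₀ ε₂₉ hγ₀ le_rfl (betaContH_thetaFill_of_cont_dominated F a₀ ε₂₉ hγh hc hd))

/-- ★★★ **K0ᴬ BY NAME FROM THE FOUR LIMIT-KERNEL BOX LETTERS AT COFINALLY SMALL RADII** (through the socket's projection `record13SepCoPHInhabitedAx_of_cofinalBetaSocketAxBody`; K0ᴬ reads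
only the |β| half — the composite is typed because the SAME producer is the junction's `hβc`).  CONDITIONAL on the displayed supply; K0ᴬ stmt-QuantumFields-27238 OPEN.
[cite: Balaban1987RG1, Thm 1 p.259, Thm 2 p.259, Thm 3 p.264, (1.21)–(1.22) p.264, (5.42) p.297] -/
theorem record13SepCoPHInhabitedAx_of_plimBoxLetters_cofinalRadii
    (H : ∀ (F : T4Family) (a : ℝ), 0 < a → ∃ a₀ : ℝ, 0 < a₀ ∧ a₀ ≤ a ∧ ∃ (γ₀ ε₂₉ M : ℝ) (e : ℕ → ℝ), 0 < γ₀ ∧ γ₀ ≤ 1 / 2 ∧ 0 < ε₂₉ ∧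
      RecordPlimAbsMomentOnBoxAx F a₀ ε₂₉ γ₀ M ∧ RecordPlimContOnBoxAx F a₀ ε₂₉ γ₀ ∧ RecordPlimMomentDominatedOnBoxAx F a₀ ε₂₉ γ₀ ∧
        RecordPlimMomentNegPartOnBoxAx F a₀ ε₂₉ γ₀ e) :
    Summit.QuantumFields.YangMills.Theses.BalabanUVNodes.Record13SepCoPHInhabitedAx :=
  record13SepCoPHInhabitedAx_of_cofinalBetaSocketAxBody fun F a ha => by
    obtain ⟨a₀, ha₀, hle, γ₀, ε₂₉, M, e, hγ₀, hγh, hε, habs, hc, hd, hneg⟩ := H F a ha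
    exact cofinalBetaSocketAxBody_of_plimBoxLetters F a₀ ε₂₉ ha₀ hle hγ₀ hγh hε habs hc hd hneg

/-- ★★★ … and from (L-absmom-box) + (L-cont-box) + (L-dom-box) + (L-AF-box) at cofinally small radii.  CONDITIONAL; K0ᴬ OPEN.
[cite: Balaban1987RG1, Thm 1 p.259, Thm 2 (0.31) p.259, Thm 3 p.264, (1.22) p.264, (5.44) p.297] -/
theorem record13SepCoPHInhabitedAx_of_plimBoxLetters_eventuallyNonneg_cofinalRadii
    (H : ∀ (F : T4Family) (a : ℝ), 0 < a → ∃ a₀ : ℝ, 0 < a₀ ∧ a₀ ≤ a ∧ ∃ (γ₀ ε₂₉ M : ℝ) (k₀ : ℕ), 0 < γ₀ ∧ γ₀ ≤ 1 / 2 ∧ 0 < ε₂₉ ∧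
      RecordPlimAbsMomentOnBoxAx F a₀ ε₂₉ γ₀ M ∧ RecordPlimContOnBoxAx F a₀ ε₂₉ γ₀ ∧ RecordPlimMomentDominatedOnBoxAx F a₀ ε₂₉ γ₀ ∧
        RecordPlimMomentEventuallyNonnegOnBoxAx F a₀ ε₂₉ γ₀ k₀) :
    Summit.QuantumFields.YangMills.Theses.BalabanUVNodes.Record13SepCoPHInhabitedAx :=
  record13SepCoPHInhabitedAx_of_cofinalBetaSocketAxBody fun F a ha => by
    obtain ⟨a₀, ha₀, hle, γ₀, ε₂₉, M, k₀, hγ₀, hγh, hε, habs, hc, hd, hev⟩ := H F a ha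
    exact cofinalBetaSocketAxBody_of_plimBoxLetters_eventuallyNonneg F a₀ ε₂₉ ha₀ hle hγ₀ hγh hε habs hc hd hev

/-- ★★★ … and with PER-SCALE box (5.10) in place of (L-dom-box) (the rated (C) road `betaContH_thetaFill_of_cont_decayBox`; floor from (L-AF-box)).  CONDITIONAL; K0ᴬ OPEN.
[cite: Balaban1987RG1, Thm 1 p.259, Thm 2 (0.31) p.259, Thm 3 p.264, (1.22) p.264, (5.10) p.293, (5.44) p.297] -/
theorem record13SepCoPHInhabitedAx_of_contDecayBox_eventuallyNonneg_cofinalRadii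
    (H : ∀ (F : T4Family) (a : ℝ), 0 < a → ∃ a₀ : ℝ, 0 < a₀ ∧ a₀ ≤ a ∧ ∃ (γ₀ ε₂₉ M : ℝ) (k₀ : ℕ), 0 < γ₀ ∧ γ₀ ≤ 1 / 2 ∧ 0 < ε₂₉ ∧
      RecordPlimAbsMomentOnBoxAx F a₀ ε₂₉ γ₀ M ∧ RecordPlimContOnBoxAx F a₀ ε₂₉ γ₀ ∧
        (∀ k : ℕ, ∃ C δ₁ : ℝ, 0 < δ₁ ∧ ∀ (v : Fin (k + 1) → ℝ), v ∈ Box γ₀ k → Decay510 (recordPlimAx F a₀ ε₂₉ k v 0 1) C δ₁) ∧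
        RecordPlimMomentEventuallyNonnegOnBoxAx F a₀ ε₂₉ γ₀ k₀) :
    Summit.QuantumFields.YangMills.Theses.BalabanUVNodes.Record13SepCoPHInhabitedAx :=
  record13SepCoPHInhabitedAx_of_cofinalBetaSocketAxBody fun F a ha => by
    obtain ⟨a₀, ha₀, hle, γ₀, ε₂₉, M, k₀, hγ₀, hγh, hε, habs, hc, hdec, hev⟩ := H F a ha
    exact cofinalBetaSocketAxBody_of_absMomentBox_of_floor_of_cont F a₀ ε₂₉ ha₀ hle hγ₀ hγh hε habs hγ₀ le_rfl
      (socketFloor_thetaFill_of_betaPartialSumsLowerH F a₀ ε₂₉ hγ₀ le_rfl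
        (betaPartialSumsLowerH_thetaFill_of_lowerBox_eventuallyNonneg F a₀ ε₂₉ hγh (nonneg_of_recordPlimAbsMomentOnBoxAx F a₀ ε₂₉ hγ₀ habs)
          (betaBox_thetaFill_of_recordPlimAbsMomentOnBoxAx F a₀ ε₂₉ hγh habs).2 hev))
      (socketCont_thetaFill_of_betaContH F a₀ ε₂₉ hγ₀ le_rfl (betaContH_thetaFill_of_cont_decayBox F a₀ ε₂₉ hγh hc hdec))

-- AXIOM CENSUS of the rate-free limit-kernel box-letter door: standard axioms only (no `sorryAx`).
#print axioms record13SepCoPHInhabitedAx_of_plimBoxLetters_cofinalRadii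
--§6e-END

end Summit.QuantumFields.YangMills.Theorems.K0AxMomentRoad
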